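import Literature.MathematicalPhysics.KineticTheory.CellChain

/-!
# Mixed pinned chains: the conjunct's quartic chain with a real cell profile

Topic `Literature/MathematicalPhysics/KineticTheory`, grouping namespace `…KineticTheory.HeatConduction`
(as `FouriersLaw.lean`, `CellChain.lean`). Definition request `defn-SiteDependentChain` (route
`AtomisticToContinuum/FouriersLaw/Theses/MatthiessenIncrements`, items PrefixIncrementBounds
stmt-3610, SingleImpurity stmt-3611, MixedSteadyStates stmt-3612, ProfileCalibration stmt-3613, which
inline the objects below as `let`-bindings `U V H L J SS Resp`).

## `SiteDependentChain` is `SiteChain`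

The requested notion — the Cuneo–Eckmann–Hairer–Rey-Bellet oscillator network (§2 eq. (2.1)–(2.2):
vertex potentials `U_v`, edge potentials `V_e`, Langevin baths on a vertex subset) restricted to the
path graph `{0, …, N-1}` with baths at the two ends, data `U V : ℕ → ℝ → ℝ`, `γ : ℝ`, with
`hamiltonian / generator / bondCurrent / totalCurrent / IsSteadyState` copied verbatim from
`OscillatorChain` under `P.U ↦ P.U i.val`, `P.V ↦ P.V i.val` — is ALREADY in the tree as
`Literature.MathematicalPhysics.KineticTheory.HeatConduction.SiteChain` (`CellChain.lean`), and is
not re-declared under a second name. Dictionary for the requesting route: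

* `SiteDependentChain` ↦ `SiteChain`; its `hamiltonian`, `generator`, `bondCurrent`, `totalCurrent`,
  `IsSteadyState` are the route's `let H, L, J, (∑ ∫ J), SS` (same formulas, literally), and
  `SiteChain.IsResponseCoeff N T D` is its `let Resp`;
* the embedding `OscillatorChain.toSiteDependent` ↦ `OscillatorChain.toSiteChain`
  (`= ⟨fun _ => P.U, fun _ => P.V, P.γ⟩`), with the `rfl` agreement lemmas
  `OscillatorChain.toSiteChain_hamiltonian / _generator / _bondCurrent / _totalCurrent /
  _isSteadyState`;
* locality in the data: `SiteChain.hamiltonian_congr / generator_congr / bondCurrent_congr /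
  totalCurrent_congr / isSteadyState_congr / isResponseCoeff_congr`.

## Contents (what is new here)

* `mixedPinnedChain ω₂ lam β γ (c : ℕ → ℝ) : SiteChain` — the `ω₂`-pinned, unit-coupling harmonic
  chain between Langevin baths `γ` carrying the quartic terms of the conjunct's `pinnedChain ω₂ lam β γ`
  with a real CELL PROFILE `c`: pinning `U_i(q) = ω₂ q²/2 + c_i·lam·q⁴/4` at site `i`, coupling
  `V_i(r) = r²/2 + c_i·β·r⁴/4` on the bond `(i, i+1)`. The literal shape `c i * lam * q ^ 4 / 4` makes
  the constant profile `c ≡ a` DEFINITIONALLY the homogeneous chain `pinnedChain ω₂ (a * lam) (a * β) γ`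
  (`mixedPinnedChain_const`, by `rfl`, an equality of site chains; hence `_const_isSteadyState`,
  `_const_bondCurrent`, … by `rfl`), so `c ≡ 1` is the conjunct's chain (`_const_one`, up to
  `one_mul`) and `c ≡ 0` the solved pinned harmonic chain `pinnedChain ω₂ 0 0 γ` (`_const_zero`).
* `{0,1}`-valued profiles are the cell chains of `CellChain.lean`: `mixedPinnedChain_indicator`
  (`c i ∈ {0,1}` as `if b i then 1 else 0` gives `cellChain ω₂ lam β γ b`); in particular the
  prefix profiles `1_[0,k)` (`mixedPinnedChain_prefix`) and the single-impurity profiles `1_{x}`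
  (`mixedPinnedChain_single`) of the route.
* Locality in the profile (request (3)): if `c i = c' i` for all `i < N` then every size-`N` object
  of `mixedPinnedChain … c` and `… c'` coincides — `mixedPinnedChain_hamiltonian_congr`,
  `_generator_congr`, `_bondCurrent_congr`, `_totalCurrent_congr`, `_isSteadyState_congr`,
  `_isResponseCoeff_congr` (from the `SiteChain.*_congr` lemmas).
* Calculus of the potentials: `mixedPinnedChain_deriv_U` (`U_i' q = ω₂ q + c_i lam q³`),
  `mixedPinnedChain_deriv_V` (`V_i' r = r + c_i β r³`), and the explicit bond current
  `mixedPinnedChain_bondCurrent_apply`.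

## Sources

Bonetto–Lebowitz–Rey-Bellet 2000, §3 eq. (8) (crystal Hamiltonian with site-dependent pinning
`U_i`: "for many purpose it is enough to put the potential `U_i` on only some of the atoms") and
§10 item 1 ("one finds a finite conductivity if some nonlinearity is present … analogous result
are found adding a 4-th order term to `U(q)` as well as to `V(q)`"); Cuneo–Eckmann–Hairer–
Rey-Bellet 2018, §2 eq. (2.1)–(2.2) (networks: `H = ∑_v (p_v²/2 + U_v(q_v)) + ∑_e V_e(δq_e)`,
baths `-γ_v p_v dt + √(2T_vγ_v) dW_v` on `v ∈ B`); Dhar 2008, §5 first display (the general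
disordered pinned quartic chain `∑_l [p_l²/2m_l + k_o x_l²/2 + λ x_l⁴/4] + ∑_l [k r_l²/2 + ν r_l⁴/4]`;
here unit masses and site-dependent quartic amplitudes `λ_l = c_l·lam`, `ν_l = c_l·β` instead of
random masses).

## Design choices / what is NOT here

* No second name for `SiteChain`, no copy of its API (CONVENTIONS §4: an existing Literature def is
  imported, not restated).
* The profile is real-valued and unrestricted (`c : ℕ → ℝ`); the route restricts to `0 ≤ c i ≤ 1`
  in its hypotheses. Indexing by `ℕ` (not `Fin N`) so that one profile serves every length.
* NO claim about existence or uniqueness of steady states of mixed chains is made or vendored: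
  Cuneo–Eckmann–Hairer–Rey-Bellet's Thm 2.13 needs all interaction potentials nearly homogeneous of
  ONE common degree `ℓ_i ≥ ℓ_p` with coercive, locally injective limits (C3–C5; "the requirement
  that all interaction potentials have the same degree `ℓ_i` is crucial", Remark 2.11); at length
  `N` this covers profiles with `c i > 0` on every bond `i + 1 < N` (common degree 4), not profiles
  vanishing on an interior bond while positive elsewhere (degrees 2 and 4 mixed) — the content of the
  route's item MixedSteadyStates, a statement to prove, not a fact.
* Searched (`lean search`): `SiteDependent`, `mixedPinnedChain`, `InhomogeneousChain`
  (`InhomogeneousChainEnvironment.lean`: a fixed-length variant `InhomogeneousChain N` with per-site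
  bath couplings, for composite system/environment chains — different data), `cellChain`
  (`{0,1}`-profiles only; linked here by `mixedPinnedChain_indicator`).
-/

noncomputable section

open MeasureTheory

namespace Literature.MathematicalPhysics.KineticTheory.HeatConduction

/-- The MIXED PINNED CHAIN with cell profile `c : ℕ → ℝ`: the site chain with pinning
`U_i(q) = ω₂ q²/2 + c_i·lam·q⁴/4` at site `i`, coupling `V_i(r) = r²/2 + c_i·β·r⁴/4` on the bond
`(i, i+1)` and bath coupling `γ` — the quartic terms of the conjunct's `pinnedChain ω₂ lam β γ`
weighted sitewise by `c_i` inside the `ω₂`-pinned unit-coupling harmonic host. Constant profile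
`c ≡ a` is definitionally `pinnedChain ω₂ (a * lam) (a * β) γ` (`mixedPinnedChain_const`); indicator
profiles are the cell chains `cellChain` (`mixedPinnedChain_indicator`). An oscillator network in the
sense of Cuneo–Eckmann–Hairer–Rey-Bellet 2018, §2 eq. (2.1)–(2.2), on the path graph with baths at
both ends; for the quartic-in-`U`-and-`V` family see Bonetto–Lebowitz–Rey-Bellet 2000, §3 eq. (8)
(site-dependent `U_i`) and §10 item 1, and Dhar 2008, §5 (first display). No existence/uniqueness
of steady states is asserted (CEHRB Thm 2.13 requires one common interaction degree, Remark 2.11).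
[cite: CuneoEckmannHairerReyBellet2018, §2 eq. (2.1)-(2.2)] -/
def mixedPinnedChain (ω₂ lam β γ : ℝ) (c : ℕ → ℝ) : SiteChain where
  U i q := ω₂ * q ^ 2 / 2 + c i * lam * q ^ 4 / 4
  V i r := r ^ 2 / 2 + c i * β * r ^ 4 / 4
  γ := γ

section MixedPinnedChain

variable (ω₂ lam β γ : ℝ)

/-! ### Unfolding -/

/-- The bath coupling of a mixed pinned chain. [folklore] -/
@[simp] theorem mixedPinnedChain_γ (c : ℕ → ℝ) : (mixedPinnedChain ω₂ lam β γ c).γ = γ := rfl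

/-- The pinning at site `i`, evaluated. [folklore] -/
theorem mixedPinnedChain_U_apply (c : ℕ → ℝ) (i : ℕ) (q : ℝ) :
    (mixedPinnedChain ω₂ lam β γ c).U i q = ω₂ * q ^ 2 / 2 + c i * lam * q ^ 4 / 4 :=
  rfl

/-- The coupling of the bond `(i, i+1)`, evaluated. [folklore] -/
theorem mixedPinnedChain_V_apply (c : ℕ → ℝ) (i : ℕ) (r : ℝ) :
    (mixedPinnedChain ω₂ lam β γ c).V i r = r ^ 2 / 2 + c i * β * r ^ 4 / 4 :=
  rfl

/-- Sitewise, the mixed chain is the homogeneous pinned quartic chain with amplitudes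
`(c_i lam, c_i β)` (pinning), definitionally. [folklore] -/
theorem mixedPinnedChain_U (c : ℕ → ℝ) (i : ℕ) :
    (mixedPinnedChain ω₂ lam β γ c).U i = (pinnedChain ω₂ (c i * lam) (c i * β) γ).U :=
  rfl

/-- Sitewise, the mixed chain is the homogeneous pinned quartic chain with amplitudes
`(c_i lam, c_i β)` (coupling), definitionally. [folklore] -/
theorem mixedPinnedChain_V (c : ℕ → ℝ) (i : ℕ) :
    (mixedPinnedChain ω₂ lam β γ c).V i = (pinnedChain ω₂ (c i * lam) (c i * β) γ).V :=
  rfl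

/-! ### Constant profiles: the homogeneous chains, by `rfl` -/

/-- A constant profile `c ≡ a` IS the homogeneous chain `pinnedChain ω₂ (a·lam) (a·β) γ` (literal
equality of site chains, by `rfl`). [folklore] -/
theorem mixedPinnedChain_const (a : ℝ) :
    mixedPinnedChain ω₂ lam β γ (fun _ => a) = (pinnedChain ω₂ (a * lam) (a * β) γ).toSiteChain :=
  rfl

/-- Constant profile: the Hamiltonian is that of `pinnedChain ω₂ (a·lam) (a·β) γ`, by `rfl`.
[folklore] -/
theorem mixedPinnedChain_const_hamiltonian (a : ℝ) (N : ℕ) :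
    (mixedPinnedChain ω₂ lam β γ (fun _ => a)).hamiltonian N =
      (pinnedChain ω₂ (a * lam) (a * β) γ).hamiltonian N :=
  rfl

/-- Constant profile: the generator is that of `pinnedChain ω₂ (a·lam) (a·β) γ`, by `rfl`.
[folklore] -/
theorem mixedPinnedChain_const_generator (a : ℝ) (N : ℕ) :
    (mixedPinnedChain ω₂ lam β γ (fun _ => a)).generator N =
      (pinnedChain ω₂ (a * lam) (a * β) γ).generator N :=
  rfl

/-- Constant profile: the bond currents are those of `pinnedChain ω₂ (a·lam) (a·β) γ`, by `rfl`.
[folklore] -/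
theorem mixedPinnedChain_const_bondCurrent (a : ℝ) (N : ℕ) :
    (mixedPinnedChain ω₂ lam β γ (fun _ => a)).bondCurrent N =
      (pinnedChain ω₂ (a * lam) (a * β) γ).bondCurrent N :=
  rfl

/-- Constant profile: the total current is that of `pinnedChain ω₂ (a·lam) (a·β) γ`, by `rfl`.
[folklore] -/
theorem mixedPinnedChain_const_totalCurrent (a : ℝ) {N : ℕ} (μ : Measure (PhaseSpace N)) :
    (mixedPinnedChain ω₂ lam β γ (fun _ => a)).totalCurrent μ =
      (pinnedChain ω₂ (a * lam) (a * β) γ).totalCurrent μ :=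
  rfl

/-- Constant profile: the steady states are those of `pinnedChain ω₂ (a·lam) (a·β) γ`, by `rfl`
(the clause (b) of the route's ProfileCalibration). [folklore] -/
theorem mixedPinnedChain_const_isSteadyState (a : ℝ) (N : ℕ) :
    (mixedPinnedChain ω₂ lam β γ (fun _ => a)).IsSteadyState N =
      (pinnedChain ω₂ (a * lam) (a * β) γ).IsSteadyState N :=
  rfl

/-- Constant profile: the response coefficients are those of `pinnedChain ω₂ (a·lam) (a·β) γ`
(as a site chain), by `rfl`. [folklore] -/
theorem mixedPinnedChain_const_isResponseCoeff (a : ℝ) (N : ℕ) :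
    (mixedPinnedChain ω₂ lam β γ (fun _ => a)).IsResponseCoeff N =
      (pinnedChain ω₂ (a * lam) (a * β) γ).toSiteChain.IsResponseCoeff N :=
  rfl

/-- Profile `c ≡ 1`: the conjunct's chain `pinnedChain ω₂ lam β γ` (up to `one_mul`). [folklore] -/
theorem mixedPinnedChain_const_one :
    mixedPinnedChain ω₂ lam β γ (fun _ => 1) = (pinnedChain ω₂ lam β γ).toSiteChain := by
  rw [mixedPinnedChain_const, one_mul, one_mul]

/-- Profile `c ≡ 0`: the pinned harmonic host `pinnedChain ω₂ 0 0 γ` (up to `zero_mul`).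
[folklore] -/
theorem mixedPinnedChain_const_zero :
    mixedPinnedChain ω₂ lam β γ (fun _ => 0) = (pinnedChain ω₂ 0 0 γ).toSiteChain := by
  rw [mixedPinnedChain_const, zero_mul, zero_mul]

/-! ### Indicator profiles: the cell chains -/

/-- A `{0,1}`-valued profile — the indicator of a cell set `b : ℕ → Bool` — gives the cell chain
`cellChain ω₂ lam β γ b` of `CellChain.lean` (equality of site chains). [folklore] -/
theorem mixedPinnedChain_indicator (b : ℕ → Bool) :
    mixedPinnedChain ω₂ lam β γ (fun i => if b i then 1 else 0) = cellChain ω₂ lam β γ b := by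
  refine SiteChain.ext (funext fun i => funext fun q => ?_) (funext fun i => funext fun r => ?_) rfl
  · show ω₂ * q ^ 2 / 2 + (if b i then (1 : ℝ) else 0) * lam * q ^ 4 / 4 =
      ω₂ * q ^ 2 / 2 + (if b i then lam else 0) * q ^ 4 / 4
    cases b i <;> simp
  · show r ^ 2 / 2 + (if b i then (1 : ℝ) else 0) * β * r ^ 4 / 4 =
      r ^ 2 / 2 + (if b i then β else 0) * r ^ 4 / 4
    cases b i <;> simp

/-- The prefix profile `1_[0,k)` (quartic cells exactly at the sites `i < k`) gives the cell chain
with indicator `i < k`. [folklore] -/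
theorem mixedPinnedChain_prefix (k : ℕ) :
    mixedPinnedChain ω₂ lam β γ (fun i => if i < k then 1 else 0) =
      cellChain ω₂ lam β γ (fun i => decide (i < k)) := by
  rw [← mixedPinnedChain_indicator]
  simp only [decide_eq_true_eq]

/-- The single-impurity profile `1_{x}` (one quartic cell at site `x`) gives the cell chain with
indicator `i = x`. [folklore] -/
theorem mixedPinnedChain_single (x : ℕ) :
    mixedPinnedChain ω₂ lam β γ (fun i => if i = x then 1 else 0) =
      cellChain ω₂ lam β γ (fun i => decide (i = x)) := by
  rw [← mixedPinnedChain_indicator]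
  simp only [decide_eq_true_eq]

/-! ### Locality in the profile -/

/-- Locality (Hamiltonian): at length `N` only the profile below `N` matters. [folklore] -/
theorem mixedPinnedChain_hamiltonian_congr {c c' : ℕ → ℝ} {N : ℕ} (h : ∀ i, i < N → c i = c' i) :
    (mixedPinnedChain ω₂ lam β γ c).hamiltonian N = (mixedPinnedChain ω₂ lam β γ c').hamiltonian N :=
  SiteChain.hamiltonian_congr (fun i hi => by rw [mixedPinnedChain_U, mixedPinnedChain_U, h i hi])
    (fun i hi => by rw [mixedPinnedChain_V, mixedPinnedChain_V, h i hi])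

/-- Locality (generator). [folklore] -/
theorem mixedPinnedChain_generator_congr {c c' : ℕ → ℝ} {N : ℕ} (h : ∀ i, i < N → c i = c' i) :
    (mixedPinnedChain ω₂ lam β γ c).generator N = (mixedPinnedChain ω₂ lam β γ c').generator N :=
  SiteChain.generator_congr (fun i hi => by rw [mixedPinnedChain_U, mixedPinnedChain_U, h i hi])
    (fun i hi => by rw [mixedPinnedChain_V, mixedPinnedChain_V, h i hi]) rfl

/-- Locality (bond currents; the clause (a), second half, of the route's ProfileCalibration).
[folklore] -/
theorem mixedPinnedChain_bondCurrent_congr {c c' : ℕ → ℝ} {N : ℕ} (h : ∀ i, i < N → c i = c' i) :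
    (mixedPinnedChain ω₂ lam β γ c).bondCurrent N =
      (mixedPinnedChain ω₂ lam β γ c').bondCurrent N :=
  SiteChain.bondCurrent_congr fun i hi => by rw [mixedPinnedChain_V, mixedPinnedChain_V, h i hi]

/-- Locality (total current). [folklore] -/
theorem mixedPinnedChain_totalCurrent_congr {c c' : ℕ → ℝ} {N : ℕ} (h : ∀ i, i < N → c i = c' i)
    (μ : Measure (PhaseSpace N)) :
    (mixedPinnedChain ω₂ lam β γ c).totalCurrent μ =
      (mixedPinnedChain ω₂ lam β γ c').totalCurrent μ :=
  SiteChain.totalCurrent_congr (fun i hi => by rw [mixedPinnedChain_V, mixedPinnedChain_V, h i hi]) μ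

/-- Locality (steady states; the clause (a), first half, of the route's ProfileCalibration).
[folklore] -/
theorem mixedPinnedChain_isSteadyState_congr {c c' : ℕ → ℝ} {N : ℕ} (h : ∀ i, i < N → c i = c' i) :
    (mixedPinnedChain ω₂ lam β γ c).IsSteadyState N =
      (mixedPinnedChain ω₂ lam β γ c').IsSteadyState N :=
  SiteChain.isSteadyState_congr (fun i hi => by rw [mixedPinnedChain_U, mixedPinnedChain_U, h i hi])
    (fun i hi => by rw [mixedPinnedChain_V, mixedPinnedChain_V, h i hi]) rfl

/-- Locality (response coefficients). [folklore] -/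
theorem mixedPinnedChain_isResponseCoeff_congr {c c' : ℕ → ℝ} {N : ℕ}
    (h : ∀ i, i < N → c i = c' i) :
    (mixedPinnedChain ω₂ lam β γ c).IsResponseCoeff N =
      (mixedPinnedChain ω₂ lam β γ c').IsResponseCoeff N :=
  SiteChain.isResponseCoeff_congr (fun i hi => by rw [mixedPinnedChain_U, mixedPinnedChain_U, h i hi])
    (fun i hi => by rw [mixedPinnedChain_V, mixedPinnedChain_V, h i hi]) rfl

/-! ### Calculus of the potentials and the explicit bond current -/

/-- `U_i'(q) = ω₂ q + c_i lam q³`. [folklore] -/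
theorem mixedPinnedChain_deriv_U (c : ℕ → ℝ) (i : ℕ) (q : ℝ) :
    deriv ((mixedPinnedChain ω₂ lam β γ c).U i) q = ω₂ * q + c i * lam * q ^ 3 := by
  have h : HasDerivAt (fun q : ℝ => ω₂ * q ^ 2 / 2 + c i * lam * q ^ 4 / 4)
      (ω₂ * ((2 : ℕ) * q ^ (2 - 1)) / 2 + c i * lam * ((4 : ℕ) * q ^ (4 - 1)) / 4) q :=
    (((hasDerivAt_pow 2 q).const_mul ω₂).div_const 2).add
      (((hasDerivAt_pow 4 q).const_mul (c i * lam)).div_const 4)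
  rw [show (mixedPinnedChain ω₂ lam β γ c).U i = fun q : ℝ => ω₂ * q ^ 2 / 2 + c i * lam * q ^ 4 / 4
    from rfl, h.deriv]
  push_cast
  ring

/-- `V_i'(r) = r + c_i β r³`. [folklore] -/
theorem mixedPinnedChain_deriv_V (c : ℕ → ℝ) (i : ℕ) (r : ℝ) :
    deriv ((mixedPinnedChain ω₂ lam β γ c).V i) r = r + c i * β * r ^ 3 := by
  have h : HasDerivAt (fun r : ℝ => r ^ 2 / 2 + c i * β * r ^ 4 / 4)
      ((2 : ℕ) * r ^ (2 - 1) / 2 + c i * β * ((4 : ℕ) * r ^ (4 - 1)) / 4) r :=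
    ((hasDerivAt_pow 2 r).div_const 2).add
      (((hasDerivAt_pow 4 r).const_mul (c i * β)).div_const 4)
  rw [show (mixedPinnedChain ω₂ lam β γ c).V i = fun r : ℝ => r ^ 2 / 2 + c i * β * r ^ 4 / 4
    from rfl, h.deriv]
  push_cast
  ring

/-- The bond current of the mixed chain, explicitly:
`j_i = -½ (p_i + p_{i+1}) (r + c_i β r³)`, `r = q_{i+1} - q_i` (`0` at the last site).
[Bonetto–Lebowitz–Rey-Bellet 2000, §5.2 eq. (23)] [folklore] -/
theorem mixedPinnedChain_bondCurrent_apply (c : ℕ → ℝ) (N : ℕ) (i : Fin N) (x : PhaseSpace N) :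
    (mixedPinnedChain ω₂ lam β γ c).bondCurrent N i x =
      ∑ j : Fin N, if j.val = i.val + 1 then
        -((x.2 i + x.2 j) / 2 *
          ((x.1 j - x.1 i) + c i.val * β * (x.1 j - x.1 i) ^ 3)) else 0 := by
  simp only [SiteChain.bondCurrent, mixedPinnedChain_deriv_V]

end MixedPinnedChain

end Literature.MathematicalPhysics.KineticTheory.HeatConduction
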